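import Summits.QuantumFields.YangMills.Theorems.BalabanUVNodesK0Stub1CombColumnLetter
import Summits.QuantumFields.YangMills.Theorems.BalabanUVNodesK0Stub1CorrectedCurrentJunction

/-!
# K0⁷ STUB 1 (`stub_prop8StepCoP13`), sub-target S4a — **THE k-UNIFORM SUP LETTER OF THE CORRECTED CURRENT** (file 2∕2):
# `‖(RᵀW)(b)‖ ≤ 12·d·(d+2)·L · sup_b ‖W(b)‖` for the skew Frobenius transpose `Rᵀ` of `∂∘T` (p618723) — NO `L^k`, NO `N`

Cell `pub-ymgap`, width seat `pub-ymgap-k0-s1-w1` g6 (CLAIM-1 ∕ INTENT-1–2; the located on-path S4a item (t3) of HOME `HANDOFF.md` § g5).  `--kind proof --supports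
stmt-QuantumFields-20541 --as helper`; count-neutral.  File 1∕2 = `…K0Stub1CombColumnLetter` (the column letter of `T`).
[15] = [Balaban1985Variational]; [B5] = [Balaban1984PropagatorsI]; [B6] = [Balaban1984PropagatorsII]; [B7] = [Balaban1985Averaging].

WHY.  p618723∕p620347 turn the RECORD's criticality (socket `h127rec`) into print's (128) hypothesis `h128` of the heart files for the CORRECTED current `W′ = W + RᵀW`,
`⟪δ, RᵀW⟫ = ⟪∂(Tδ), W⟫` on skew tests.  The heart's letters ([15] (158)∕(165), p604735 `letter165_rows_of_critical128_bodyAt`) take the current through the (98) SUP slot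
`|W| ≤ C₄ρ²`; so the corrected current needs `‖RᵀW‖_∞ ≤ C·‖W‖_∞` with `C` independent of the number of levels `k` (p617458∕p618723 only recorded the `k`-dependent letter
`(d+2)L^{k+1}` of `T`).  THIS FILE: `C = 12·d·(d+2)·L`.  Mechanism: `(RᵀW)(b′)` is skew-Hermitian; test it against the skew RANK-TWO fields `δ = δ_{b′}·(uv* − vu*)`:
`Re tr((uv* − vu*)ᴴX) = 2·Re⟨u, Xv⟩` for skew `X`, while the transpose identity and file 1's column letter give `⟪∂(Tδ), W⟫ = Σ_b (c(b₊) − c(b₋))·Re tr((uv* − vu*)ᴴW(b))`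
with `Σ_x |c(x)| ≤ 6(d+2)L` and `|Re tr((uv*)ᴴ Y)| = |Re⟨u, Yv⟩| ≤ ‖Y‖‖u‖‖v‖`; each fine site is an end-point of `2d` bonds; the operator norm of `X` is read off `Re⟨u, Xv⟩`.

WHAT IS PROVED (sorry-free; no definition; axioms standard; `M = M_N(ℂ)`, operator norm `Matrix.Norms.L2Operator`).
* §1 DUALITY: `trace_conjTranspose_vecMulVec_mul` (`tr((uv*)ᴴY) = ⟨u, Yv⟩`), `abs_re_trace_conjTranspose_vecMulVec_mul_le`, `conjTranspose_rankTwoSkew`,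
  `re_trace_rankTwoSkew_of_skew` (`= 2 Re⟨u, Xv⟩` for skew `X`), `abs_re_trace_rankTwoSkew_le` (`≤ 2‖Y‖‖u‖‖v‖`), ★ `l2_opNorm_le_of_rankTwoSkew_tests`.
* §2 ★★ `norm_transpose_apply_le` — ABSTRACT LETTER: any `T` whose columns are `c(x)•Z(b′)` with `Σ_x|c(x)| ≤ K`, any skew-valued `Rᵀ` with the transpose identity on
  skew tests ⇒ `‖(RᵀW)(b′)‖ ≤ 2·d·K·s` whenever `‖W(b)‖ ≤ s`.
* §3 ★★★ `exists_correctedCurrent_letter` ∕ ★★★ `exists_correctedCurrent_letter_lieSU` — p618723's `exists_correctedCurrent(_lieSU)` VERBATIM (same five conjuncts: `T` skew∕𝔰𝔲,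
  `T` letter, `Rᵀ` skew, transpose identity, the junction h127rec ⇒ h128) PLUS the sixth: **`∀ W s, 0 ≤ s → (∀ b, ‖W b‖ ≤ s) → ∀ b, ‖Rᵀ W b‖ ≤ 12·d·((d+2)L)·s`**
  (hypothesis `2 ≤ P.d`; the record has `d = 4`).

HONEST SCOPE.  Finite-dimensional duality + file 1's walk counts; the junction conjunct is p618723's argument re-run for the `T` obtained together with its dichotomy clause
(the ∃ of p618723 does not export it); NO estimate of Bałaban's is asserted; the SOCKET `h127rec` is NOT produced here (S2∕S4b); `stub_prop8StepCoP13` ∕ K0⁷ NOT closed;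
N07 NOT discharged; counts unmoved (28∕28 · 5∕27); one finite 𝕋⁴ programme at fixed ε — R4 closes the conditional finite-𝕋⁴ rung `BalabanLadder.UV` only, never the summit;
the YM mass gap (Clay) is NOT proved by any of this; nothing continuum ∕ ℝ⁴ ∕ OS.  No `sorry`, no `def`, no `instance`, no `notation`.

References: [15] (44)–(47) p.285, (98) p.292, (127)–(128) p.297, (158) p.302, (165) p.303; [B5] (1.18) p.20; [B6] (2.1)–(2.4) p.224, (2.19)–(2.20) p.226; [B7] (62) p.28.
-/

set_option autoImplicit false
noncomputable section
open scoped BigOperators Matrix Matrix.Norms.L2Operator InnerProductSpace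

namespace Summit.QuantumFields.YangMills.Theorems.K0Stub1CorrectedCurrentLetter

open Literature.MathematicalPhysics.QuantumFieldTheory.Balaban1983to89
open LatticeFieldCalculus (bondAvgIter)
open BlockAveragingEMLLinearised (combMean)
open B15DeterminingSets (embIter)
open T4AdjointCovarianceUnitary (lieSU mem_lieSU_iff)
open B6SectADomainsV1 (Domains)
open B6SectAOperatorsV1 (BondIdx QE)
open Node00 (dIterL)
open WithLp (toLp ofLp)
open Summit.QuantumFields.YangMills.Theorems.K0Stub1CorrectedCurrentJunction (exists_transpose_pairing pairing_add_left pairing_add_right pairing_sub_right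
  pairing_smul_right pairing_conjTranspose_right_of_skew)
open Summit.QuantumFields.YangMills.Theorems.K0Stub1FlatAveragingDictionaryLevels (exists_linear_gauge_dIterL_one_eq_zero_of_bondAvgIter_eq_zero lamSite_or_of_lamBond)
open Summit.QuantumFields.YangMills.Theorems.K0Stub1CombColumnLetter (exists_column_of_dichotomy)

variable {P : Params} {N : ℕ}

/-! ## §1  Duality on `M_N(ℂ)` with the operator norm: rank-two skew tests read `Re⟨u, Xv⟩` -/

section Duality

/-- `tr((u v*)ᴴ Y) = ⟨u, Y v⟩` (Euclidean inner product, conjugate-linear in `u`). [folklore] -/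
theorem trace_conjTranspose_vecMulVec_mul (u v : EuclideanSpace ℂ (Fin N)) (Y : Matrix (Fin N) (Fin N) ℂ) :
    ((Matrix.vecMulVec (ofLp u) (star (ofLp v)))ᴴ * Y).trace = ⟪u, Matrix.toEuclideanCLM (n := Fin N) (𝕜 := ℂ) Y v⟫_ℂ := by
  rw [Matrix.conjTranspose_vecMulVec, star_star, Matrix.vecMulVec_mul, Matrix.trace_vecMulVec, EuclideanSpace.inner_eq_star_dotProduct,
    Matrix.ofLp_toEuclideanCLM, dotProduct_comm (Y *ᵥ ofLp v), Matrix.dotProduct_mulVec, dotProduct_comm]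

/-- `|Re tr((u v*)ᴴ Y)| ≤ ‖Y‖·‖u‖·‖v‖` (operator norm). [folklore] -/
theorem abs_re_trace_conjTranspose_vecMulVec_mul_le (u v : EuclideanSpace ℂ (Fin N)) (Y : Matrix (Fin N) (Fin N) ℂ) :
    |((Matrix.vecMulVec (ofLp u) (star (ofLp v)))ᴴ * Y).trace.re| ≤ ‖Y‖ * ‖u‖ * ‖v‖ := by
  rw [trace_conjTranspose_vecMulVec_mul]
  refine (Complex.abs_re_le_norm _).trans ((norm_inner_le_norm _ _).trans ?_)
  have h := (Matrix.toEuclideanCLM (n := Fin N) (𝕜 := ℂ) Y).le_opNorm v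
  rw [Matrix.l2_opNorm_toEuclideanCLM] at h
  calc ‖u‖ * ‖Matrix.toEuclideanCLM (n := Fin N) (𝕜 := ℂ) Y v‖ ≤ ‖u‖ * (‖Y‖ * ‖v‖) := mul_le_mul_of_nonneg_left h (norm_nonneg _)
    _ = ‖Y‖ * ‖u‖ * ‖v‖ := by ring

/-- The rank-two test `u v* − v u*` is skew-Hermitian. [folklore] -/
theorem conjTranspose_rankTwoSkew (u v : EuclideanSpace ℂ (Fin N)) :
    (Matrix.vecMulVec (ofLp u) (star (ofLp v)) - Matrix.vecMulVec (ofLp v) (star (ofLp u)))ᴴ =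
      -(Matrix.vecMulVec (ofLp u) (star (ofLp v)) - Matrix.vecMulVec (ofLp v) (star (ofLp u))) := by
  rw [Matrix.conjTranspose_sub, Matrix.conjTranspose_vecMulVec, Matrix.conjTranspose_vecMulVec, star_star, star_star, neg_sub]

/-- For a SKEW-Hermitian `X`: `Re tr((u v* − v u*)ᴴ X) = 2·Re⟨u, Xv⟩` (`⟨v, Xu⟩ = conj⟨Xᴴv, u⟩… = −conj⟨u, Xv⟩`). [folklore] -/
theorem re_trace_rankTwoSkew_of_skew (u v : EuclideanSpace ℂ (Fin N)) {X : Matrix (Fin N) (Fin N) ℂ} (hX : Xᴴ = -X) :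
    ((Matrix.vecMulVec (ofLp u) (star (ofLp v)) - Matrix.vecMulVec (ofLp v) (star (ofLp u)))ᴴ * X).trace.re =
      2 * (⟪u, Matrix.toEuclideanCLM (n := Fin N) (𝕜 := ℂ) X v⟫_ℂ).re := by
  rw [Matrix.conjTranspose_sub, Matrix.sub_mul, Matrix.trace_sub, Complex.sub_re, trace_conjTranspose_vecMulVec_mul, trace_conjTranspose_vecMulVec_mul]
  -- `⟨v, Xu⟩ = conj ⟨Xu, v⟩ = conj ⟨u, Xᴴ v⟩ = −conj ⟨u, X v⟩`
  have hadj : ⟪v, Matrix.toEuclideanCLM (n := Fin N) (𝕜 := ℂ) X u⟫_ℂ = -(starRingEnd ℂ) ⟪u, Matrix.toEuclideanCLM (n := Fin N) (𝕜 := ℂ) X v⟫_ℂ := by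
    rw [← inner_conj_symm, ← ContinuousLinearMap.adjoint_inner_right, ← ContinuousLinearMap.star_eq_adjoint, ← map_star,
      Matrix.star_eq_conjTranspose, hX, map_neg, neg_apply, inner_neg_right, map_neg]
  rw [hadj, Complex.neg_re, Complex.conj_re]
  ring

/-- `|Re tr((u v* − v u*)ᴴ Y)| ≤ 2‖Y‖·‖u‖·‖v‖` for ANY `Y`. [folklore] -/
theorem abs_re_trace_rankTwoSkew_le (u v : EuclideanSpace ℂ (Fin N)) (Y : Matrix (Fin N) (Fin N) ℂ) :
    |((Matrix.vecMulVec (ofLp u) (star (ofLp v)) - Matrix.vecMulVec (ofLp v) (star (ofLp u)))ᴴ * Y).trace.re| ≤ 2 * ‖Y‖ * ‖u‖ * ‖v‖ := by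
  rw [Matrix.conjTranspose_sub, Matrix.sub_mul, Matrix.trace_sub, Complex.sub_re]
  have h1 := abs_re_trace_conjTranspose_vecMulVec_mul_le u v Y
  have h2 := abs_re_trace_conjTranspose_vecMulVec_mul_le v u Y
  calc _ ≤ |((Matrix.vecMulVec (ofLp u) (star (ofLp v)))ᴴ * Y).trace.re| + |((Matrix.vecMulVec (ofLp v) (star (ofLp u)))ᴴ * Y).trace.re| := abs_sub _ _
    _ ≤ ‖Y‖ * ‖u‖ * ‖v‖ + ‖Y‖ * ‖v‖ * ‖u‖ := add_le_add h1 h2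
    _ = 2 * ‖Y‖ * ‖u‖ * ‖v‖ := by ring

/-- ★ **THE OPERATOR NORM OF A SKEW-HERMITIAN MATRIX FROM ITS RANK-TWO SKEW TESTS**: if `Re tr((u v* − v u*)ᴴ X) ≤ 2C‖u‖‖v‖` for all `u, v`, then `‖X‖ ≤ C`
(take `u = Xv`: `‖Xv‖² = Re⟨Xv, Xv⟩ ≤ C‖Xv‖‖v‖`). [folklore] -/
theorem l2_opNorm_le_of_rankTwoSkew_tests {X : Matrix (Fin N) (Fin N) ℂ} (hX : Xᴴ = -X) {C : ℝ} (hC : 0 ≤ C)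
    (h : ∀ u v : EuclideanSpace ℂ (Fin N),
      ((Matrix.vecMulVec (ofLp u) (star (ofLp v)) - Matrix.vecMulVec (ofLp v) (star (ofLp u)))ᴴ * X).trace.re ≤ 2 * C * ‖u‖ * ‖v‖) :
    ‖X‖ ≤ C := by
  rw [← Matrix.l2_opNorm_toEuclideanCLM]
  refine ContinuousLinearMap.opNorm_le_bound _ hC fun v => ?_
  set w := Matrix.toEuclideanCLM (n := Fin N) (𝕜 := ℂ) X v with hw
  have hsq : ‖w‖ * ‖w‖ ≤ C * ‖v‖ * ‖w‖ := by
    have h1 := h w v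
    rw [re_trace_rankTwoSkew_of_skew w v hX, ← hw] at h1
    have h2 : ‖w‖ ^ 2 = (⟪w, w⟫_ℂ).re := by rw [norm_sq_eq_re_inner (𝕜 := ℂ)]; rfl
    nlinarith [h2]
  by_cases hw0 : ‖w‖ = 0
  · rw [hw0]; positivity
  · exact le_of_mul_le_mul_right hsq (lt_of_le_of_ne (norm_nonneg _) (Ne.symm hw0))

end Duality

/-! ## §2  The abstract letter: column mass of `T` + the skew transpose identity ⇒ the sup letter of `Rᵀ` -/

section Abstract

/-- Every fine site is the final point of `d` bonds and the initial point of `d` bonds: `Σ_b (|c(b₊)| + |c(b₋)|) = 2d·Σ_x |c(x)|`. [cite: Balaban1985Averaging, (5) p.18] -/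
theorem sum_bond_ends_eq (c : Site P 0 → ℝ) :
    ∑ b : PBond P 0, (|c b.tgt| + |c b.src|) = 2 * P.d * ∑ x : Site P 0, |c x| := by
  rw [Finset.sum_add_distrib, B10StarCount.sum_pbond, B10StarCount.sum_pbond]
  have h1 : ∑ x : Site P 0, ∑ μ : Fin P.d, |c ((⟨x, μ⟩ : PBond P 0).tgt)| = P.d * ∑ x : Site P 0, |c x| := by
    rw [Finset.sum_comm]
    have hμ : ∀ μ : Fin P.d, ∑ x : Site P 0, |c ((⟨x, μ⟩ : PBond P 0).tgt)| = ∑ x : Site P 0, |c x| := fun μ =>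
      Equiv.sum_comp (B10StarCount.shiftEquiv μ) (fun x => |c x|)
    simp only [hμ, Finset.sum_const, Finset.card_univ, Fintype.card_fin, nsmul_eq_mul]
  have h2 : ∑ x : Site P 0, ∑ _μ : Fin P.d, |c ((⟨x, _μ⟩ : PBond P 0).src)| = P.d * ∑ x : Site P 0, |c x| := by
    simp only [Finset.sum_const, Finset.card_univ, Fintype.card_fin, nsmul_eq_mul]
    rw [Finset.mul_sum]
  rw [h1, h2]
  ring

/-- ★★ **THE ABSTRACT LETTER.**  Let `T` (fine bond fields → fine gauge functions) have columns `(TZ)(x) = c(x)•Z(b′)` of mass `Σ_x |c(x)| ≤ K` on every field `Z` supported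
on one bond `b′`, and let `Rᵀ` be SKEW-valued with the transpose identity `⟪δ, RᵀW⟫ = ⟪∂(Tδ), W⟫` on skew tests.  Then `‖(RᵀW)(b′)‖ ≤ 2·d·K·s` whenever `‖W(b)‖ ≤ s` for
all `b` (operator norm on `M_N(ℂ)`; no linearity of `T` or `Rᵀ` is used). [cite: Balaban1985Variational, (98) p.292, (127)-(128) p.297] -/
theorem norm_transpose_apply_le
    (T : (PBond P 0 → Matrix (Fin N) (Fin N) ℂ) → Site P 0 → Matrix (Fin N) (Fin N) ℂ)
    (Rt : (PBond P 0 → Matrix (Fin N) (Fin N) ℂ) → PBond P 0 → Matrix (Fin N) (Fin N) ℂ)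
    (hRt : ∀ W b, (Rt W b)ᴴ = -Rt W b)
    (htr : ∀ δ W : PBond P 0 → Matrix (Fin N) (Fin N) ℂ, (∀ b, (δ b)ᴴ = -δ b) →
      ∑ b, ((δ b)ᴴ * Rt W b).trace.re = ∑ b, ((T δ b.tgt - T δ b.src)ᴴ * W b).trace.re)
    {K : ℝ} (hK : 0 ≤ K)
    (hcol : ∀ (b' : PBond P 0) (Z : PBond P 0 → Matrix (Fin N) (Fin N) ℂ), (∀ b, b ≠ b' → Z b = 0) →
      ∃ c : Site P 0 → ℝ, (∀ x, T Z x = c x • Z b') ∧ ∑ x, |c x| ≤ K)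
    (W : PBond P 0 → Matrix (Fin N) (Fin N) ℂ) {s : ℝ} (hs : 0 ≤ s) (hW : ∀ b, ‖W b‖ ≤ s) (b' : PBond P 0) :
    ‖Rt W b'‖ ≤ 2 * P.d * K * s := by
  classical
  refine l2_opNorm_le_of_rankTwoSkew_tests (hRt W b') (by positivity) fun u v => ?_
  set E := Matrix.vecMulVec (ofLp u) (star (ofLp v)) - Matrix.vecMulVec (ofLp v) (star (ofLp u)) with hE
  have hEskew : Eᴴ = -E := conjTranspose_rankTwoSkew u v
  -- the single-bond skew test `δ = δ_{b′}·E`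
  let δ : PBond P 0 → Matrix (Fin N) (Fin N) ℂ := fun b => if b = b' then E else 0
  have hδb' : δ b' = E := if_pos rfl
  have hδ0 : ∀ b, b ≠ b' → δ b = 0 := fun b hb => if_neg hb
  have hδskew : ∀ b, (δ b)ᴴ = -δ b := fun b => by
    by_cases hb : b = b'
    · simp only [δ, if_pos hb, hEskew]
    · simp only [δ, if_neg hb, Matrix.conjTranspose_zero, neg_zero]
  -- the transpose identity on this test: `Re tr(Eᴴ·(RᵀW)(b′)) = Σ_b (c(b₊) − c(b₋))·Re tr(Eᴴ W(b))`
  have hL : ∑ b, ((δ b)ᴴ * Rt W b).trace.re = (Eᴴ * Rt W b').trace.re := by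
    rw [Finset.sum_eq_single b' (fun b _ hb => by rw [hδ0 b hb, Matrix.conjTranspose_zero, Matrix.zero_mul, Matrix.trace_zero, Complex.zero_re])
      (fun h => absurd (Finset.mem_univ _) h), hδb']
  obtain ⟨c, hc, hcK⟩ := hcol b' δ hδ0
  have hR : ∑ b, ((T δ b.tgt - T δ b.src)ᴴ * W b).trace.re = ∑ b, (c b.tgt - c b.src) * (Eᴴ * W b).trace.re := by
    refine Finset.sum_congr rfl fun b _ => ?_
    rw [hc, hc, hδb', ← sub_smul, Matrix.conjTranspose_smul, star_trivial, Matrix.smul_mul, Matrix.trace_smul, Complex.smul_re, smul_eq_mul]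
  have hmain := htr δ W hδskew
  rw [hL, hR] at hmain
  rw [hmain]
  -- the bound, bond by bond
  have huv : 0 ≤ 2 * s * ‖u‖ * ‖v‖ := by positivity
  have hterm : ∀ b : PBond P 0, (c b.tgt - c b.src) * (Eᴴ * W b).trace.re ≤ (|c b.tgt| + |c b.src|) * (2 * s * ‖u‖ * ‖v‖) := fun b => by
    have h1 : |(Eᴴ * W b).trace.re| ≤ 2 * ‖W b‖ * ‖u‖ * ‖v‖ := abs_re_trace_rankTwoSkew_le u v (W b)
    have h2 : 2 * ‖W b‖ * ‖u‖ * ‖v‖ ≤ 2 * s * ‖u‖ * ‖v‖ := by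
      have := hW b
      have hu := norm_nonneg u
      have hv := norm_nonneg v
      nlinarith [mul_nonneg hu hv]
    calc (c b.tgt - c b.src) * (Eᴴ * W b).trace.re ≤ |(c b.tgt - c b.src) * (Eᴴ * W b).trace.re| := le_abs_self _
      _ = |c b.tgt - c b.src| * |(Eᴴ * W b).trace.re| := abs_mul _ _
      _ ≤ (|c b.tgt| + |c b.src|) * (2 * s * ‖u‖ * ‖v‖) := mul_le_mul (abs_sub _ _) (h1.trans h2) (abs_nonneg _) (by positivity)
  have hd0 : (0 : ℝ) ≤ 2 * P.d := by positivity
  calc ∑ b, (c b.tgt - c b.src) * (Eᴴ * W b).trace.re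
      ≤ ∑ b : PBond P 0, (|c b.tgt| + |c b.src|) * (2 * s * ‖u‖ * ‖v‖) := Finset.sum_le_sum fun b _ => hterm b
    _ = (2 * P.d * ∑ x, |c x|) * (2 * s * ‖u‖ * ‖v‖) := by rw [← Finset.sum_mul, sum_bond_ends_eq]
    _ ≤ (2 * P.d * K) * (2 * s * ‖u‖ * ‖v‖) := mul_le_mul_of_nonneg_right (mul_le_mul_of_nonneg_left hcK hd0) huv
    _ = 2 * (2 * P.d * K * s) * ‖u‖ * ‖v‖ := by ring

end Abstract

/-! ## §3  The corrected current WITH its k-uniform sup letter (p618723's junction, same construction, one more conjunct) -/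

section Main

variable [NeZero N] (D : Domains P)
  (hcollar : ∀ (i : ℕ) (e : PBond P (i + 1)), D.LamBond (i + 1) e → ∀ z : Site P i, (blockOf z = e.src ∨ blockOf z = e.tgt) → z ∈ D.Om i)

include hcollar in
/-- ★★★ **THE CORRECTED-CURRENT JUNCTION WITH THE k-UNIFORM SUP LETTER.**  For every nested family `D` with the collar property (and `d ≥ 2`): the dictionary's
gauge map `T` (p617458) and an ℝ-linear SKEW-valued `Rᵀ` with `⟪δ, RᵀW⟫ = ⟪∂(Tδ), W⟫` on skew tests such that — besides p618723's five conjuncts verbatim (`T` skew-preserving,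
`T`'s letter, `Rᵀ` skew, the transpose identity, and hK + hDK + SOCKET h127rec ⇒ p595460's `h128` for `W′ = W + RᵀW`) — **`‖(RᵀW)(b)‖ ≤ 12·d·(d+2)·L · s` whenever
`‖W(b)‖ ≤ s` for all `b`**: the corrected current is admissible in the (98) sup slot with `C₄′ = (1 + 12d(d+2)L)·C₄`, uniformly in the number of levels.
[cite: Balaban1985Variational, (98) p.292, (127)-(128) p.297, (44)-(47) p.285, (158) p.302; Balaban1984PropagatorsII, (2.19)-(2.20) p.226; Balaban1985Averaging, (62) p.28] -/
theorem exists_correctedCurrent_letter (hd : 2 ≤ P.d) :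
    ∃ (T : (PBond P 0 → Matrix (Fin N) (Fin N) ℂ) →ₗ[ℂ] (Site P 0 → Matrix (Fin N) (Fin N) ℂ))
      (Rt : (PBond P 0 → Matrix (Fin N) (Fin N) ℂ) →ₗ[ℝ] (PBond P 0 → Matrix (Fin N) (Fin N) ℂ)),
      (∀ Z : PBond P 0 → Matrix (Fin N) (Fin N) ℂ, (∀ b, (Z b)ᴴ = -Z b) → ∀ x, (T Z x)ᴴ = -T Z x) ∧
      (∀ (Z : PBond P 0 → Matrix (Fin N) (Fin N) ℂ) (s : ℝ), 0 ≤ s → (∀ b, ‖Z b‖ ≤ s) →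
        ∀ x, ‖T Z x‖ ≤ ((P.d + 2 : ℕ) : ℝ) * (P.L : ℝ) ^ (D.k + 1) * s) ∧
      (∀ W b, (Rt W b)ᴴ = -(Rt W b)) ∧
      (∀ δ W : PBond P 0 → Matrix (Fin N) (Fin N) ℂ, (∀ b, (δ b)ᴴ = -δ b) →
        ∑ b, ((δ b)ᴴ * Rt W b).trace.re = ∑ b, ((T δ b.tgt - T δ b.src)ᴴ * W b).trace.re) ∧
      (∀ (W : PBond P 0 → Matrix (Fin N) (Fin N) ℂ) (s : ℝ), 0 ≤ s → (∀ b, ‖W b‖ ≤ s) →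
        ∀ b, ‖Rt W b‖ ≤ 12 * P.d * (((P.d + 2) * P.L : ℕ) : ℝ) * s) ∧
      ∀ {instDE : DecidableEq (PBond P 0)} {QV : (PBond P 0 → Matrix (Fin N) (Fin N) ℂ) →ₗ[ℂ] (BondIdx D → Matrix (Fin N) (Fin N) ℂ)},
        (∀ (A : PBond P 0 → Matrix (Fin N) (Fin N) ℂ) (t : BondIdx D),
          QV A t = ∑ j, ((WithLp.ofLp (QE D (WithLp.toLp 2 (Pi.single j 1))) t : ℝ) : ℂ) • A j) →
        ∀ (DVA Kf Wf : PBond P 0 → Matrix (Fin N) (Fin N) ℂ),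
          (∀ μ : Site P 0 → Matrix (Fin N) (Fin N) ℂ, (∀ x, (μ x)ᴴ = -μ x) → ∑ b, ((μ b.tgt - μ b.src)ᴴ * Kf b).trace.re = 0) →
          (∀ δ : PBond P 0 → Matrix (Fin N) (Fin N) ℂ, (∀ b, (δ b)ᴴ = -δ b) → QV δ = 0 →
            ∑ b, ((δ b)ᴴ * DVA b).trace.re = ∑ b, ((δ b)ᴴ * Kf b).trace.re) →
          (∀ δ : PBond P 0 → Matrix (Fin N) (Fin N) ℂ, (∀ b, (δ b)ᴴ = -δ b) →
            (∀ (j : ℕ) (c : PBond P j), D.LamBond j c → dIterL j (1 : PBond P 0 → Matrix (Fin N) (Fin N) ℂ) δ c = 0) →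
            ∑ b, ((δ b)ᴴ * (Kf b + Wf b)).trace.re = 0) →
          ∀ δ : PBond P 0 → Matrix (Fin N) (Fin N) ℂ, (∀ b, (δ b)ᴴ = -δ b) → QV δ = 0 →
            ∑ b, ((δ b)ᴴ * (DVA b + (Wf b + Rt Wf b))).trace.re = 0 := by
  classical
  -- the multi-level dictionary, reading (2.3), WITH its dichotomy clause
  obtain ⟨T, hTskew, -, -, -, hTdich, hTletter, hTker⟩ := exists_linear_gauge_dIterL_one_eq_zero_of_bondAvgIter_eq_zero (N := N) D hcollar
    (fun j b => D.LamBond j b) (fun j b hb => lamSite_or_of_lamBond D hb) (fun j c hs ht => ⟨Or.inl hs.1, hs.2, ht.2⟩)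
  -- file 1: the column letter of `T`
  have hcol : ∀ (b' : PBond P 0) (Z : PBond P 0 → Matrix (Fin N) (Fin N) ℂ), (∀ b, b ≠ b' → Z b = 0) →
      ∃ c : Site P 0 → ℝ, (∀ x, T Z x = c x • Z b') ∧ ∑ x, |c x| ≤ 6 * (((P.d + 2) * P.L : ℕ) : ℝ) := fun b' Z hZ =>
    exists_column_of_dichotomy D hcollar (I := fun j b => D.LamBond j b) (fun j b hb => lamSite_or_of_lamBond D hb) hd T hTdich b' Z hZ
  -- the real-linear map `S = ∂ ∘ T` and its Frobenius transpose (as in p618723)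
  let S : (PBond P 0 → Matrix (Fin N) (Fin N) ℂ) →ₗ[ℝ] (PBond P 0 → Matrix (Fin N) (Fin N) ℂ) :=
    { toFun := fun Z b => T Z b.tgt - T Z b.src
      map_add' := fun Z Z' => by funext b; simp only [map_add, Pi.add_apply]; abel
      map_smul' := fun a Z => by
        funext b
        simp only [RingHom.id_apply, Pi.smul_apply]
        rw [← Complex.coe_smul, map_smul, Pi.smul_apply, Pi.smul_apply, Complex.coe_smul, Complex.coe_smul, smul_sub] }
  have hS : ∀ Z b, S Z b = T Z b.tgt - T Z b.src := fun _ _ => rfl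
  obtain ⟨St, hSt⟩ := exists_transpose_pairing S
  let skw : (PBond P 0 → Matrix (Fin N) (Fin N) ℂ) →ₗ[ℝ] (PBond P 0 → Matrix (Fin N) (Fin N) ℂ) :=
    { toFun := fun X b => (1 / 2 : ℝ) • (X b - (X b)ᴴ)
      map_add' := fun X X' => by funext b; simp only [Pi.add_apply, Matrix.conjTranspose_add]; rw [← smul_add]; congr 1; abel
      map_smul' := fun a X => by
        funext b
        simp only [Pi.smul_apply, RingHom.id_apply, Matrix.conjTranspose_smul, star_trivial]
        rw [← smul_sub, smul_comm] }
  have hskw : ∀ X b, skw X b = (1 / 2 : ℝ) • (X b - (X b)ᴴ) := fun _ _ => rfl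
  have hRtskew : ∀ W b, ((skw ∘ₗ St) W b)ᴴ = -((skw ∘ₗ St) W b) := fun W b => by
    rw [LinearMap.comp_apply, hskw, Matrix.conjTranspose_smul, star_trivial, Matrix.conjTranspose_sub, Matrix.conjTranspose_conjTranspose, ← smul_neg, neg_sub]
  have htr : ∀ δ W : PBond P 0 → Matrix (Fin N) (Fin N) ℂ, (∀ b, (δ b)ᴴ = -δ b) →
      ∑ b, ((δ b)ᴴ * (skw ∘ₗ St) W b).trace.re = ∑ b, ((T δ b.tgt - T δ b.src)ᴴ * W b).trace.re := by
    intro δ W hδ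
    have h2 : ∑ b, ((δ b)ᴴ * (skw ∘ₗ St) W b).trace.re = (1 / 2 : ℝ) * ∑ b, ((δ b)ᴴ * (St W b - (St W b)ᴴ)).trace.re := by
      rw [← pairing_smul_right]; rfl
    rw [h2, pairing_sub_right, pairing_conjTranspose_right_of_skew hδ, hSt]
    simp only [hS]
    ring
  refine ⟨T, skw ∘ₗ St, fun Z hZ x => ?_, hTletter, hRtskew, htr, fun W s hs hW b => ?_, ?_⟩
  · -- `T` preserves skewness (`star` = `ᴴ`)
    have h := hTskew Z (fun b => by rw [Matrix.star_eq_conjTranspose]; exact hZ b) x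
    rwa [Matrix.star_eq_conjTranspose] at h
  · -- THE LETTER: §2 with file 1's column mass `K = 6(d+2)L`
    have h := norm_transpose_apply_le (⇑T) (⇑(skw ∘ₗ St)) hRtskew htr (by positivity) hcol W hs hW b
    calc ‖(skw ∘ₗ St) W b‖ ≤ 2 * P.d * (6 * (((P.d + 2) * P.L : ℕ) : ℝ)) * s := h
      _ = 12 * P.d * (((P.d + 2) * P.L : ℕ) : ℝ) * s := by ring
  · -- the junction (p618723's argument for this `T`)
    intro instDE QV hQV DVA Kf Wf hK hDK h127 δ hδ hQ
    have hδ' : ∀ b, star (δ b) = -δ b := fun b => by rw [Matrix.star_eq_conjTranspose]; exact hδ b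
    have h0' := (K0Stub1FlatAveragingDictionary.QV_eq_zero_iff D hQV δ).1 hQ
    have h0 : ∀ (j : ℕ) (c : PBond P j), D.LamBond j c → bondAvgIter j δ c = 0 := fun j c hc =>
      h0' ⟨⟨⟨j, Nat.lt_succ_of_le (D.le_of_lamBond hc)⟩, c⟩, hc⟩
    have hν : ∀ x, (T δ x)ᴴ = -T δ x := fun x => by
      have h := hTskew δ hδ' x; rwa [Matrix.star_eq_conjTranspose] at h
    have hsum : ∀ b, (δ b + (T δ b.tgt - T δ b.src))ᴴ = -(δ b + (T δ b.tgt - T δ b.src)) := fun b => by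
      rw [Matrix.conjTranspose_add, Matrix.conjTranspose_sub, hδ, hν, hν]; abel
    have h1 := h127 (fun b => δ b + (T δ b.tgt - T δ b.src)) hsum (hTker δ hδ' h0)
    rw [pairing_add_left, pairing_add_right, pairing_add_right, hK (T δ) hν, zero_add] at h1
    rw [pairing_add_right, pairing_add_right, hDK δ hδ hQ, htr δ Wf hδ]
    linarith

include hcollar in
/-- ★★★ **THE SAME WITH 𝔰𝔲(N)-VALUED TESTS ON BOTH SIDES** (p618723 `exists_correctedCurrent_lieSU` verbatim + the k-uniform sup letter of `Rᵀ`): the shape of p604735's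
`h128` (tests `δ : PBond → 𝔰𝔲(N)` read in `M_N(ℂ)`) and of dag-n07-w1's socket convention (`qLin j 1 δ c = dIterL j 1 ↑δ c`).  Same `T`, same `Rᵀ`, same letter
`‖(RᵀW)(b)‖ ≤ 12·d·(d+2)·L·s`. [cite: Balaban1985Variational, (98) p.292, (127)-(128) p.297, (3)-(4) p.278, (44)-(47) p.285; Balaban1984PropagatorsII, (2.19)-(2.20) p.226] -/
theorem exists_correctedCurrent_letter_lieSU (hd : 2 ≤ P.d) :
    ∃ (T : (PBond P 0 → Matrix (Fin N) (Fin N) ℂ) →ₗ[ℂ] (Site P 0 → Matrix (Fin N) (Fin N) ℂ))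
      (Rt : (PBond P 0 → Matrix (Fin N) (Fin N) ℂ) →ₗ[ℝ] (PBond P 0 → Matrix (Fin N) (Fin N) ℂ)),
      (∀ Z : PBond P 0 → Matrix (Fin N) (Fin N) ℂ, (∀ b, Z b ∈ lieSU (Fin N)) → ∀ x, T Z x ∈ lieSU (Fin N)) ∧
      (∀ (Z : PBond P 0 → Matrix (Fin N) (Fin N) ℂ) (s : ℝ), 0 ≤ s → (∀ b, ‖Z b‖ ≤ s) →
        ∀ x, ‖T Z x‖ ≤ ((P.d + 2 : ℕ) : ℝ) * (P.L : ℝ) ^ (D.k + 1) * s) ∧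
      (∀ W b, (Rt W b)ᴴ = -(Rt W b)) ∧
      (∀ δ W : PBond P 0 → Matrix (Fin N) (Fin N) ℂ, (∀ b, (δ b)ᴴ = -δ b) →
        ∑ b, ((δ b)ᴴ * Rt W b).trace.re = ∑ b, ((T δ b.tgt - T δ b.src)ᴴ * W b).trace.re) ∧
      (∀ (W : PBond P 0 → Matrix (Fin N) (Fin N) ℂ) (s : ℝ), 0 ≤ s → (∀ b, ‖W b‖ ≤ s) →
        ∀ b, ‖Rt W b‖ ≤ 12 * P.d * (((P.d + 2) * P.L : ℕ) : ℝ) * s) ∧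
      ∀ {instDE : DecidableEq (PBond P 0)} {QV : (PBond P 0 → Matrix (Fin N) (Fin N) ℂ) →ₗ[ℂ] (BondIdx D → Matrix (Fin N) (Fin N) ℂ)},
        (∀ (A : PBond P 0 → Matrix (Fin N) (Fin N) ℂ) (t : BondIdx D),
          QV A t = ∑ j, ((WithLp.ofLp (QE D (WithLp.toLp 2 (Pi.single j 1))) t : ℝ) : ℂ) • A j) →
        ∀ (DVA Kf Wf : PBond P 0 → Matrix (Fin N) (Fin N) ℂ),
          (∀ μ : Site P 0 → lieSU (Fin N),
            ∑ b, (((μ b.tgt : Matrix (Fin N) (Fin N) ℂ) - (μ b.src : Matrix (Fin N) (Fin N) ℂ))ᴴ * Kf b).trace.re = 0) →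
          (∀ δ : PBond P 0 → lieSU (Fin N), QV (fun b => (δ b : Matrix (Fin N) (Fin N) ℂ)) = 0 →
            ∑ b, (((δ b : Matrix (Fin N) (Fin N) ℂ))ᴴ * DVA b).trace.re = ∑ b, (((δ b : Matrix (Fin N) (Fin N) ℂ))ᴴ * Kf b).trace.re) →
          (∀ δ : PBond P 0 → lieSU (Fin N),
            (∀ (j : ℕ) (c : PBond P j), D.LamBond j c →
              dIterL j (1 : PBond P 0 → Matrix (Fin N) (Fin N) ℂ) (fun b => (δ b : Matrix (Fin N) (Fin N) ℂ)) c = 0) →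
            ∑ b, (((δ b : Matrix (Fin N) (Fin N) ℂ))ᴴ * (Kf b + Wf b)).trace.re = 0) →
          ∀ δ : PBond P 0 → lieSU (Fin N), QV (fun b => (δ b : Matrix (Fin N) (Fin N) ℂ)) = 0 →
            ∑ b, (((δ b : Matrix (Fin N) (Fin N) ℂ))ᴴ * (DVA b + (Wf b + Rt Wf b))).trace.re = 0 := by
  classical
  obtain ⟨T, hTskew, hTsu, -, -, hTdich, hTletter, hTker⟩ := exists_linear_gauge_dIterL_one_eq_zero_of_bondAvgIter_eq_zero (N := N) D hcollar
    (fun j b => D.LamBond j b) (fun j b hb => lamSite_or_of_lamBond D hb) (fun j c hs ht => ⟨Or.inl hs.1, hs.2, ht.2⟩)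
  have hcol : ∀ (b' : PBond P 0) (Z : PBond P 0 → Matrix (Fin N) (Fin N) ℂ), (∀ b, b ≠ b' → Z b = 0) →
      ∃ c : Site P 0 → ℝ, (∀ x, T Z x = c x • Z b') ∧ ∑ x, |c x| ≤ 6 * (((P.d + 2) * P.L : ℕ) : ℝ) := fun b' Z hZ =>
    exists_column_of_dichotomy D hcollar (I := fun j b => D.LamBond j b) (fun j b hb => lamSite_or_of_lamBond D hb) hd T hTdich b' Z hZ
  let S : (PBond P 0 → Matrix (Fin N) (Fin N) ℂ) →ₗ[ℝ] (PBond P 0 → Matrix (Fin N) (Fin N) ℂ) :=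
    { toFun := fun Z b => T Z b.tgt - T Z b.src
      map_add' := fun Z Z' => by funext b; simp only [map_add, Pi.add_apply]; abel
      map_smul' := fun a Z => by
        funext b
        simp only [RingHom.id_apply, Pi.smul_apply]
        rw [← Complex.coe_smul, map_smul, Pi.smul_apply, Pi.smul_apply, Complex.coe_smul, Complex.coe_smul, smul_sub] }
  have hS : ∀ Z b, S Z b = T Z b.tgt - T Z b.src := fun _ _ => rfl
  obtain ⟨St, hSt⟩ := exists_transpose_pairing S
  let skw : (PBond P 0 → Matrix (Fin N) (Fin N) ℂ) →ₗ[ℝ] (PBond P 0 → Matrix (Fin N) (Fin N) ℂ) :=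
    { toFun := fun X b => (1 / 2 : ℝ) • (X b - (X b)ᴴ)
      map_add' := fun X X' => by funext b; simp only [Pi.add_apply, Matrix.conjTranspose_add]; rw [← smul_add]; congr 1; abel
      map_smul' := fun a X => by
        funext b
        simp only [Pi.smul_apply, RingHom.id_apply, Matrix.conjTranspose_smul, star_trivial]
        rw [← smul_sub, smul_comm] }
  have hskw : ∀ X b, skw X b = (1 / 2 : ℝ) • (X b - (X b)ᴴ) := fun _ _ => rfl
  have hRtskew : ∀ W b, ((skw ∘ₗ St) W b)ᴴ = -((skw ∘ₗ St) W b) := fun W b => by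
    rw [LinearMap.comp_apply, hskw, Matrix.conjTranspose_smul, star_trivial, Matrix.conjTranspose_sub, Matrix.conjTranspose_conjTranspose, ← smul_neg, neg_sub]
  have htr : ∀ δ W : PBond P 0 → Matrix (Fin N) (Fin N) ℂ, (∀ b, (δ b)ᴴ = -δ b) →
      ∑ b, ((δ b)ᴴ * (skw ∘ₗ St) W b).trace.re = ∑ b, ((T δ b.tgt - T δ b.src)ᴴ * W b).trace.re := by
    intro δ W hδ
    have h2 : ∑ b, ((δ b)ᴴ * (skw ∘ₗ St) W b).trace.re = (1 / 2 : ℝ) * ∑ b, ((δ b)ᴴ * (St W b - (St W b)ᴴ)).trace.re := by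
      rw [← pairing_smul_right]; rfl
    rw [h2, pairing_sub_right, pairing_conjTranspose_right_of_skew hδ, hSt]
    simp only [hS]
    ring
  refine ⟨T, skw ∘ₗ St, hTsu, hTletter, hRtskew, htr, fun W s hs hW b => ?_, ?_⟩
  · have h := norm_transpose_apply_le (⇑T) (⇑(skw ∘ₗ St)) hRtskew htr (by positivity) hcol W hs hW b
    calc ‖(skw ∘ₗ St) W b‖ ≤ 2 * P.d * (6 * (((P.d + 2) * P.L : ℕ) : ℝ)) * s := h
      _ = 12 * P.d * (((P.d + 2) * P.L : ℕ) : ℝ) * s := by ring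
  · intro instDE QV hQV DVA Kf Wf hK hDK h127 δ hQ
    have hδ' : ∀ b, star ((δ b : Matrix (Fin N) (Fin N) ℂ)) = -(δ b : Matrix (Fin N) (Fin N) ℂ) := fun b => (mem_lieSU_iff.mp (δ b).2).1
    have hδ : ∀ b, ((δ b : Matrix (Fin N) (Fin N) ℂ))ᴴ = -(δ b : Matrix (Fin N) (Fin N) ℂ) := fun b => by
      rw [← Matrix.star_eq_conjTranspose]; exact hδ' b
    have h0' := (K0Stub1FlatAveragingDictionary.QV_eq_zero_iff D hQV (fun b => (δ b : Matrix (Fin N) (Fin N) ℂ))).1 hQ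
    have h0 : ∀ (j : ℕ) (c : PBond P j), D.LamBond j c → bondAvgIter j (fun b => (δ b : Matrix (Fin N) (Fin N) ℂ)) c = 0 := fun j c hc =>
      h0' ⟨⟨⟨j, Nat.lt_succ_of_le (D.le_of_lamBond hc)⟩, c⟩, hc⟩
    have hν : ∀ x, T (fun b => (δ b : Matrix (Fin N) (Fin N) ℂ)) x ∈ lieSU (Fin N) := hTsu _ fun b => (δ b).2
    let δ' : PBond P 0 → lieSU (Fin N) := fun b =>
      ⟨(δ b : Matrix (Fin N) (Fin N) ℂ) + (T (fun b => (δ b : Matrix (Fin N) (Fin N) ℂ)) b.tgt - T (fun b => (δ b : Matrix (Fin N) (Fin N) ℂ)) b.src),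
        Submodule.add_mem _ (δ b).2 (Submodule.sub_mem _ (hν _) (hν _))⟩
    have hδ'coe : (fun b => (δ' b : Matrix (Fin N) (Fin N) ℂ)) =
        fun b => (δ b : Matrix (Fin N) (Fin N) ℂ) + (T (fun b => (δ b : Matrix (Fin N) (Fin N) ℂ)) b.tgt - T (fun b => (δ b : Matrix (Fin N) (Fin N) ℂ)) b.src) := rfl
    have h1 := h127 δ' (by rw [hδ'coe]; exact hTker _ hδ' h0)
    have hδ'b : ∀ b, (δ' b : Matrix (Fin N) (Fin N) ℂ) =
        (δ b : Matrix (Fin N) (Fin N) ℂ) + (T (fun b => (δ b : Matrix (Fin N) (Fin N) ℂ)) b.tgt - T (fun b => (δ b : Matrix (Fin N) (Fin N) ℂ)) b.src) :=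
      fun b => rfl
    simp only [hδ'b] at h1
    rw [pairing_add_left, pairing_add_right, pairing_add_right] at h1
    have hKν := hK (fun x => ⟨T (fun b => (δ b : Matrix (Fin N) (Fin N) ℂ)) x, hν x⟩)
    rw [hKν, zero_add] at h1
    rw [pairing_add_right, pairing_add_right, hDK δ hQ, htr _ Wf hδ]
    linarith

end Main

end Summit.QuantumFields.YangMills.Theorems.K0Stub1CorrectedCurrentLetter

end
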